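import Summits.QuantumFields.YangMills.Theorems.UnitScaleTiltProp8FlatMinimizerH
import Literature.MathematicalPhysics.QuantumFieldTheory.Balaban1983to89.B5Ineq110P12Lattice
import HarnessLib

/-!
# Route `UnitScaleTilt`, crux K1 child «MinimiserStabilityRegPr» (stmt-QuantumFields-19200), leaves V2′ (one-step halving, Sect. F) and V3 (Prop. 7):
# **THE DECAYING (EXPONENTIALLY WEIGHTED `ℓ¹`) FORMS OF «|HB|» AND «|∇HB|» FOR PRINT'S FLAT `H` AT THE SETUP TORUS** — what
# [Balaban1985Variational] Sect. F (160)–(161) consume (the datum `B(x,x′)` grows like `|x − y|` away from the cube `Δ₀ ∋ y`, the kernel of `H` decays)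

Cell `ym3-torus` (HUMAN RULING D-0037, YM ladder rung R3), seat `ym3-torus-p1` gen 14 (UV side); memo HOME/UV3-NODE.md §23.  `--supports
stmt-QuantumFields-19200 --as helper`.  Sixth file of pillar F3 «flat-operator bridge» (OWNER RULING g20-№8 §A); supplements `…FlatMinimizerH` (whose `abs_H_le` /
`abs_grad_H_le` are the GLOBAL sup forms `≤ C·sup|b|`, insufficient for (161) where `|B(x,x′)| < (8d²L² + 4L²|x−y|)ε₁` is unbounded in the volume).
For the V1 field `Hb := tV⁻¹(pullR(H_k·cplx(tB b)))` of `…FlatMinimizerH` (pub-balaban's `hkT`, [B5] (1.63)):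
* **`abs_H_le_sum`** — `|(Hb)(c)| ≤ C_G(d)·Σ_{y ∈ T^{(j)}} Σ_λ e^{−δ(d)|y₀ − y|}·|b(⟨y,λ⟩)|`, `y₀` = the `j`-block of `c₋`, `|y₀ − y|` = `distSite` (sup circular
  distance on the unit torus `T^{(j)}`), `C_G(d) = M_G(d)·C_per(κ₁₆₃(d), d−1)`, `δ(d) = κ₁₆₃(d)/d` (pub-balaban `B5Hk163Torus.norm_HkOp_mulVec_le`);
* **`abs_grad_H_le_sum`** — `L^j·|(Hb)(⟨s+e_ν,μ⟩) − (Hb)(⟨s,μ⟩)| ≤ C_D(d)·Σ_y Σ_λ e^{−δ(d)|y₀ − y|}·|b(⟨y,λ⟩)|`, `C_D(d) = M_D(d)·C_per(κ₁₆₃(d), d−1)`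
  (`B5Hk163TorusHolderDecay.norm_dker_bpt_le`).
Every `P : Params` (b05's `d+1` statements reached by `cases P`; `distSite = torusSupNorm ∘ rep` by `B5Ineq110P12Lattice.distSite_eq_torusSupNorm`), every `j ≤ m + K`;
at the d = 3 carrier instantiate `P := F.P K`, `j := K − n`, `hj := FlatMinimizerH.le_T3 F n K`.  HONEST SCOPE as in `…FlatMinimizerH` (flat, one level, constants
pub-balaban's and `d`-only).  No definition, no sorry, standard axioms.  NOT a claim about the mass gap.

References: T. Bałaban, CMP **95** (1984) 17–40 [Balaban1984PropagatorsI] (1.63) p.28, p.29; CMP **102** (1985) 277–309 [Balaban1985Variational] (45)–(46) p.285,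
Sect. F (160)–(161) p.302.
-/

set_option autoImplicit false

noncomputable section

open scoped BigOperators InnerProductSpace Matrix ComplexConjugate

namespace Summit.QuantumFields.YangMills.Theorems.FlatMinimizerHDecay

open Literature.MathematicalPhysics.QuantumFieldTheory.Balaban1983to89
open Literature.MathematicalPhysics.QuantumFieldTheory.BalabanImbrieJaffe1984to88.BIJ85AxialPropagator411 (BondSpace)
open LatticeFieldCalculus B6GOneLevelV1Bridge
open B5Eq117TorusCarriers (Mk EK tV tB tB_apply)
open B5Eq118OneStroke (iterBlockOf)
open B5Prop11Plancherel (Tor fine fdiff)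
open B5SectBStatements (Fld cplx)
open B5TowerOneStroke (pullR)
open B5Block118 (bpt)
open B5Hk163Torus (HkOp norm_HkOp_mulVec_le)
open B5Hk163TorusHolder (dker fdiff_HkOp_mulVec)
open B5Hk163TorusHolderDecay (MD163 norm_dker_bpt_le CHolder163_nonneg)
open B5Hk163Decay (MG163 MG163_nonneg)
open B5Hk163Strip (kappa163 kappa163_pos)
open B4TorusKernel (periodConst)
open B4TorusKernel.MultiPeriod (torusSupNorm)
open B5Kernel166Decay (periodConst_pos)
open B6LowerBound2153Torus (toT rep toT_rep)
open B5Prop12FieldsLattice (distSite)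
open B5Ineq110P12Lattice (distSite_eq_torusSupNorm)
open B5G183FreeRowSum (fdiff_mulVec)
open FlatMinimizerH (exists_EK_eq_bpt_rep tV_symm_pullR_apply)

variable {P : Params} {j : ℕ}

/-- **THE DECAYING FORM OF «|HB|»** (what [Balaban1985Variational] Sect. F (160)–(161) consume: the datum `B` grows linearly away from the cube,
the kernel of `H` decays exponentially): for every real coarse bond field `b` and every fine bond `c` issuing from the block over `y₀`,
`|(Hb)(c)| ≤ C_G(d)·Σ_y Σ_λ e^{−δ(d)|y₀ − y|}·|b(⟨y, λ⟩)|`, `|y₀ − y|` = `B5Prop12FieldsLattice.distSite` (sup circular distance on `T^{(j)}`),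
`C_G(d) = M_G(d)C_per(κ₁₆₃(d), d−1)`, `δ(d) = κ₁₆₃(d)/d` — every `P : Params`, uniform in `j`, `L`, volume (pub-balaban `B5Hk163Torus.norm_HkOp_mulVec_le`).
[cite: Balaban1984PropagatorsI, (1.63) p.28, p.29; Balaban1985Variational, (160)-(161) p.302] -/
theorem abs_H_le_sum (hj : j ≤ P.m + P.K) (b : VecField P j ℝ) (c : PBond P 0) :
    |(tV hj).symm (pullR P.L (Mk P j) j (HkOp (P.L ^ j) (Mk P j) *ᵥ cplx (tB b))) c|
      ≤ MG163 P.d * periodConst (kappa163 P.d) (P.d - 1) *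
          ∑ y : Site P j, ∑ lam : Fin P.d,
            Real.exp (-(kappa163 P.d / P.d * distSite (Mk P j) (iterBlockOf j c.src) y)) * |b ⟨y, lam⟩| := by
  rw [tV_symm_pullR_apply]
  obtain ⟨r, hr⟩ := exists_EK_eq_bpt_rep hj c.src
  rw [hr]
  obtain ⟨dP, L, m, K, hd, hL⟩ := P
  obtain ⟨d, rfl⟩ : ∃ d, dP = d + 1 := ⟨dP - 1, by omega⟩
  haveI : NeZero (L ^ j) := ⟨by have := hL.2; positivity⟩
  refine (Complex.abs_re_le_norm _).trans ?_
  refine (norm_HkOp_mulVec_le (L ^ j) (Mk (⟨d + 1, L, m, K, hd, hL⟩ : Params) j) (cplx (tB b)) c.dir r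
    (rep (Mk (⟨d + 1, L, m, K, hd, hL⟩ : Params) j) (iterBlockOf j c.src)) (rep (Mk (⟨d + 1, L, m, K, hd, hL⟩ : Params) j))
    (toT_rep _)).trans (le_of_eq ?_)
  simp only [Nat.cast_add, Nat.cast_one, Nat.add_sub_cancel]
  congr 1
  refine Finset.sum_congr rfl fun y _ => Finset.sum_congr rfl fun lam _ => ?_
  rw [← distSite_eq_torusSupNorm]
  congr 1
  show ‖(((tB b) (y, lam) : ℝ) : ℂ)‖ = _
  rw [Complex.norm_real, Real.norm_eq_abs, tB_apply]

/-- **THE DECAYING FORM OF «|∇HB|»** (η-units): `L^j·|(Hb)(⟨s+e_ν,μ⟩) − (Hb)(⟨s,μ⟩)| ≤ C_D(d)·Σ_y Σ_λ e^{−δ(d)|y₀ − y|}·|b(⟨y, λ⟩)|`, `y₀` the block of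
`s`, `C_D(d) = M_D(d)C_per(κ₁₆₃(d), d−1)` (pub-balaban `B5Hk163TorusHolderDecay.norm_dker_bpt_le`). [cite: Balaban1984PropagatorsI, p.29 ll.1-2; Balaban1985Variational, (46) p.285, (161) p.302] -/
theorem abs_grad_H_le_sum (hj : j ≤ P.m + P.K) (b : VecField P j ℝ) (s : Site P 0) (μ ν : Fin P.d) :
    (P.L : ℝ) ^ j *
        |(tV hj).symm (pullR P.L (Mk P j) j (HkOp (P.L ^ j) (Mk P j) *ᵥ cplx (tB b))) ⟨s.shift ν, μ⟩
          - (tV hj).symm (pullR P.L (Mk P j) j (HkOp (P.L ^ j) (Mk P j) *ᵥ cplx (tB b))) ⟨s, μ⟩|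
      ≤ MD163 P.d * periodConst (kappa163 P.d) (P.d - 1) *
          ∑ y : Site P j, ∑ lam : Fin P.d,
            Real.exp (-(kappa163 P.d / P.d * distSite (Mk P j) (iterBlockOf j s) y)) * |b ⟨y, lam⟩| := by
  rw [tV_symm_pullR_apply, tV_symm_pullR_apply]
  have hdiff : (P.L : ℝ) ^ j *
        (((HkOp (P.L ^ j) (Mk P j) *ᵥ cplx (tB b)) (EK hj (s.shift ν), μ)).re
          - ((HkOp (P.L ^ j) (Mk P j) *ᵥ cplx (tB b)) (EK hj s, μ)).re)
      = ((fdiff (fine (P.L ^ j) (Mk P j)) ((P.L ^ j : ℕ) : ℂ) ν *ᵥ (HkOp (P.L ^ j) (Mk P j) *ᵥ cplx (tB b))) (EK hj s, μ)).re := by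
    rw [fdiff_mulVec, FlatPropagatorGrad.EK_shift hj s ν]
    simp only [Complex.mul_re, Complex.sub_re, Complex.sub_im, Complex.natCast_re, Complex.natCast_im, zero_mul, sub_zero]
    push_cast
    ring
  have hL0 : (0 : ℝ) < (P.L : ℝ) ^ j := pow_pos (Nat.cast_pos.2 P.L_pos) _
  have habs : ∀ t : ℝ, (P.L : ℝ) ^ j * |t| = |(P.L : ℝ) ^ j * t| := fun t => by rw [abs_mul, abs_of_pos hL0]
  dsimp only
  rw [habs, hdiff]
  refine (Complex.abs_re_le_norm _).trans ?_
  rw [fdiff_HkOp_mulVec]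
  obtain ⟨r, hr⟩ := exists_EK_eq_bpt_rep hj s
  rw [hr]
  obtain ⟨dP, L, m, K, hd, hL⟩ := P
  obtain ⟨d, rfl⟩ : ∃ d, dP = d + 1 := ⟨dP - 1, by omega⟩
  haveI : NeZero (L ^ j) := ⟨by have := hL.2; positivity⟩
  have hC : 0 ≤ MD163 (d + 1) * periodConst (kappa163 (d + 1)) d :=
    mul_nonneg (by unfold MD163; exact mul_nonneg (pow_nonneg (Real.exp_pos _).le _) (CHolder163_nonneg (0 : Fin (d + 1)) le_rfl one_pos))
      (periodConst_pos (kappa163_pos _) _).le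
  refine (norm_sum_le _ _).trans ?_
  refine (Finset.sum_le_sum fun y _ => norm_sum_le _ _).trans ?_
  simp only [Nat.cast_add, Nat.cast_one, Nat.add_sub_cancel, Finset.mul_sum]
  refine Finset.sum_le_sum fun y _ => Finset.sum_le_sum fun lam _ => ?_
  rw [norm_mul, ← mul_assoc]
  refine mul_le_mul ?_ (le_of_eq ?_) (norm_nonneg _) (mul_nonneg hC (Real.exp_pos _).le)
  · have h := norm_dker_bpt_le (L ^ j) (Mk (⟨d + 1, L, m, K, hd, hL⟩ : Params) j) μ lam ν r
      (rep (Mk (⟨d + 1, L, m, K, hd, hL⟩ : Params) j) (iterBlockOf j s)) (rep (Mk (⟨d + 1, L, m, K, hd, hL⟩ : Params) j) y)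
    rw [toT_rep _ y, ← distSite_eq_torusSupNorm] at h
    exact h
  · show ‖(((tB b) (y, lam) : ℝ) : ℂ)‖ = _
    rw [Complex.norm_real, Real.norm_eq_abs, tB_apply]

end Summit.QuantumFields.YangMills.Theorems.FlatMinimizerHDecay

end
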